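import Literature.NumberTheory.Transcendental.BrownIharaCoaction
import HarnessLib

/-!
# Ihara's law on the points of `₀Π₁` is a group law ([DG05, 5.12]; Brown's (2.4) `A ≅ ₀Π₁`)

[DeligneGoncharov2005, 5.12]: "Si on transporte à la copie `Π_{1,0}` de `Π` la loi de groupe de
`V_ω`, on obtient une nouvelle loi de groupe `∘` sur le schéma `Π`. Elle est donnée par
`a ∘ b = a·⟨a⟩₀(b)` (5.12.1)"; [Brown2012, §2.1 (2.4)]: "There is an isomorphism of schemes
`a ↦ a.₀1₁ : A ≅ ₀Π₁`. Via this identification, the action of `A` on `₀Π₁` can be computed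
explicitly."

`BrownIharaCoaction.lean` proved that Goncharov's coproduct of `𝒪(₀Π₁)` (the tree's `conv` /
`coactionG`, with the endpoint families `Iᵐ_a` of I0, I1, I3) paired with a point `a` on its
Galois side is Ihara's map `x ↦ ⟨a⟩(x)·a` (`conv_Im_eq_iharaMul`). This file proves that the
resulting binary law on series,

  `iharaLaw a x = ⟨a⟩(x)·a`  (`⟨a⟩ : e₀ ↦ e₀, e₁ ↦ a e₁ a⁻¹`; DG's `a ∘ x` in Brown's
  orientation of words),

is a **monoid law on the points of `₀Π₁`** (characters of the shuffle algebra) acting on all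
series: `1 ⋆ x = x` (`one_iharaLaw`), `a ⋆ 1 = a` (`iharaLaw_one`), `a ⋆ b` is again a point
(`iharaLaw_nil_of`, `iharaLaw_mul_of` — Goncharov's `Δ` respects the shuffle relations,
`conv_shuffle`), and

  `a ⋆ (b ⋆ x) = (a ⋆ b) ⋆ x`  (`iharaLaw_assoc`),

the last from the coassociativity of Goncharov's coproduct (`conv_assoc`,
[Goncharov2005, Prop 2.2]) and the **endpoint transport** `conv (Iᵐ_b) (Iᵐ_a) = Iᵐ_{a ⋆ b}`
(`conv_Im_Im`): a family on `{0,1}` with the path composition (iii) and trivial loops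
`Φ_{0,0} = Φ_{1,1} = 1` is determined by `Φ_{0,1}` (`family_eq_of_phi_eq`, uniqueness of
two-sided inverses: `Φ_{1,0} = Φ_{0,1}⁻¹`). Hence the hypothesis `ρ_hom` of
`MotivicGaloisData.ofIharaHom` / `pointMul_ρ_eq_iharaMul` is a homomorphy into a genuine monoid
`(₀Π₁(B), ⋆)` — the points of DG's group scheme `(Π, ∘)`. No named fact is introduced.

## References

* P. Deligne, A. B. Goncharov, *Groupes fondamentaux motiviques de Tate mixte*, Ann. Sci. ÉNS 38
  (2005), Prop. 5.11, 5.12; arXiv:math/0302267. [DeligneGoncharov2005]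
* F. Brown, *Mixed Tate motives over ℤ*, Ann. of Math. 175 (2012), §2.1 (2.4)–(2.5);
  arXiv:1102.1312. [Brown2012]
* A. B. Goncharov, Duke Math. J. 128 (2005), Prop 2.2, Thm 2.5; arXiv:math/0208144.
  [Goncharov2005]
-/

noncomputable section

open scoped BigOperators

namespace Literature.NumberTheory.Transcendental

namespace GoncharovFormalIteratedIntegrals

universe u v

variable {S : Type u} {B : Type v} [CommRing B] [DecidableEq S]

open WordSeries

/-! ## Word monomials and the identity substitution -/

/-- The monomial `X_{c₁} ⋯ X_{c_k}` of a word. [folklore] -/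
def wordX : List S → WordSeries S B
  | [] => 1
  | k :: c => X k * wordX c

/-- `wordX ∅ = 1`. [folklore] -/
@[simp] theorem wordX_nil : (wordX ([] : List S) : WordSeries S B) = 1 := rfl

/-- `wordX (k c) = X_k · wordX c`. [folklore] -/
theorem wordX_cons (k : S) (c : List S) : (wordX (k :: c) : WordSeries S B) = X k * wordX c := rfl

omit [DecidableEq S] in
/-- `1` has no coefficient on non-empty words. [folklore] -/
theorem one_apply_of_ne_nil {w : List S} (h : w ≠ []) : (1 : WordSeries S B) w = 0 := by
  obtain ⟨s, w, rfl⟩ := List.exists_cons_of_ne_nil h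
  exact one_cons s w

/-- The monomial of `c` is the indicator of `c`. [folklore] -/
theorem wordX_apply : ∀ (c w : List S), (wordX c : WordSeries S B) w = if w = c then 1 else 0
  | [], [] => by simp
  | [], s :: w => by rw [wordX_nil, one_cons, if_neg (List.cons_ne_nil s w)]
  | k :: c, [] => by
    rw [wordX_cons, X_mul_apply_nil, if_neg]
    exact fun h => List.cons_ne_nil k c h.symm
  | k :: c, s :: w => by
    rw [wordX_cons, X_mul_apply_cons, wordX_apply c w]
    by_cases hs : s = k
    · subst hs
      by_cases hw : w = c
      · subst hw; simp
      · rw [if_pos rfl, if_neg hw, if_neg (fun h => hw (List.cons_injective h))]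
    · rw [if_neg hs, if_neg]
      exact fun h => hs (List.head_eq_of_cons_eq h)

/-- **The identity substitution**: contracting against the word monomials does nothing,
`Σ_c f(c) X_c = f`. [folklore] -/
theorem contr_wordX (f : WordSeries S B) : contr f wordX = f := by
  ext w
  rw [contr_apply, Finset.sum_eq_single_of_mem w (mem_subwords.2 (List.Sublist.refl w))
    fun c _ hc => by rw [wordX_apply, if_neg (Ne.symm hc), mul_zero]]
  rw [wordX_apply, if_pos rfl, mul_one]

/-! ## Families on two base points are determined by `Φ_{0,1}` -/

/-- **A family on `{0,1}` with the path composition (iii) and trivial loops is determined by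
`Φ_{0,1}`**: `Φ_{1,0}` is then the two-sided inverse of `Φ_{0,1}` (`Φ_{1,0}Φ_{0,1} = Φ_{1,1} = 1`,
`Φ_{0,1}Φ_{1,0} = Φ_{0,0} = 1`), which is unique. This is how `Iᵐ(1; ·; 0)` is "rewritten in terms of
`𝒪(₀Π₁)` only" (I3). [cite: Brown2012, §2.4 I0–I3; DeligneGoncharov2005, Prop. 5.11] -/
theorem family_eq_of_phi_eq {K L : Bool → List Bool → Bool → B}
    (hK : ∀ a y b, phi K a y * phi K y b = phi K a b)
    (hL : ∀ a y b, phi L a y * phi L y b = phi L a b)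
    (hK00 : phi K false false = 1) (hK11 : phi K true true = 1)
    (hL00 : phi L false false = 1) (hL11 : phi L true true = 1)
    (h01 : phi K false true = phi L false true) : K = L := by
  have h10 : phi K true false = phi L true false :=
    left_inv_eq_right_inv (by rw [hK, hK11]) (by rw [h01, hL, hL00])
  funext x w y
  cases x <;> cases y
  · show phi K false false w = phi L false false w
    rw [hK00, hL00]
  · show phi K false true w = phi L false true w
    rw [h01]
  · show phi K true false w = phi L true false w
    rw [h10]
  · show phi K true true w = phi L true true w
    rw [hK11, hL11]

omit [DecidableEq S] in
/-- Goncharov's `conv` evaluates its left family at the outer endpoints only. [folklore] -/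
theorem conv_congr_left {J J' : S → List S → S → B} (K : S → List S → S → B) {a b : S}
    (h : ∀ c, J a c b = J' a c b) (w : List S) : conv J K a w b = conv J' K a w b := by
  unfold conv
  exact congrArg List.sum (List.map_congr_left fun sp _ => by rw [h])

end GoncharovFormalIteratedIntegrals

namespace Brown2012

open MZV
open GoncharovFormalIteratedIntegrals (splittings gapProdF conv conv_assoc conv_path conv_shuffle
  conv_congr_left iharaMul iharaWord iharaMul_one conv_eq_iharaMul conjWord conjWord_nil
  conjWord_cons contr contr_apply wordX wordX_nil wordX_cons contr_wordX family_eq_of_phi_eq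
  append_flatMap_eq_of_mem_splittings)
open GoncharovFormalIteratedIntegrals renaming phi → phiK, phi_apply → phiK_apply
open GoncharovFormalIteratedIntegrals.WordSeries (X delta tensor)

variable {B : Type} [CommRing B] [Algebra ℚ B]

/-! ## The law `a ⋆ x = ⟨a⟩(x)·a` -/

/-- The family reading a series `x` on the kept word, whatever the endpoints. [folklore] -/
def cstFamily (x : GoncharovFormalIteratedIntegrals.WordSeries Bool B) :
    Bool → List Bool → Bool → B := fun _ c _ => x c

omit [CommRing B] [Algebra ℚ B] in
/-- `Φ^{cst x}_{a,b} = x`. [folklore] -/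
@[simp] theorem phiK_cstFamily (x : GoncharovFormalIteratedIntegrals.WordSeries Bool B)
    (a b : Bool) : phiK (cstFamily x) a b = x := rfl

/-- **Ihara's law** `a ⋆ x = ⟨a⟩(x)·a` on series, for a point `a` of `₀Π₁` (its family `Iᵐ_a` of
I0, I1, I3): [DG05, (5.12.1)] `a ∘ b = a·⟨a⟩₀(b)` in Brown's orientation of words.
[cite: DeligneGoncharov2005, (5.11.5), (5.12.1); Brown2012, §2.1 (2.4)] -/
def iharaLaw (a x : GoncharovFormalIteratedIntegrals.WordSeries Bool B) :
    GoncharovFormalIteratedIntegrals.WordSeries Bool B :=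
  iharaMul (Im a) x

section Point

variable (a : GoncharovFormalIteratedIntegrals.WordSeries Bool B)

/-- **`a ⋆ x` is Goncharov's coproduct paired with `(a, x)`** (`conv_Im_eq_iharaMul`).
[cite: Brown2012, §2.1 (2.5), Theorem 2.4; DeligneGoncharov2005, (5.12.1)] -/
theorem iharaLaw_apply (ha1 : a [] = 1)
    (hamul : ∀ u v : List Bool, a u * a v = ((shuffleWord u v).map a).sum)
    (x : GoncharovFormalIteratedIntegrals.WordSeries Bool B) (w : List Bool) :
    iharaLaw a x w = conv (cstFamily x) (Im a) false w true :=
  (conv_Im_eq_iharaMul a ha1 hamul (cstFamily x) w).symm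

/-- `a ⋆ 1 = a`: the unit path goes to `a` ("`a ↦ a.₀1₁`"). [cite: Brown2012, §2.1 (2.4)] -/
theorem iharaLaw_one : iharaLaw a 1 = a := by
  rw [iharaLaw, iharaMul_one, phiK_Im_false_true]

/-- Constant terms: `(a ⋆ x)(∅) = x(∅)` for `a(∅) = 1`. [folklore] -/
theorem iharaLaw_nil (ha1 : a [] = 1) (x : GoncharovFormalIteratedIntegrals.WordSeries Bool B) :
    iharaLaw a x [] = x [] := by
  rw [iharaLaw, iharaMul, GoncharovFormalIteratedIntegrals.WordSeries.mul_apply_nil, contr_apply,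
    phiK_apply, Im_nil, ha1, mul_one]
  have hsub : GoncharovFormalIteratedIntegrals.subwords ([] : List Bool) = {[]} := rfl
  rw [hsub, Finset.sum_singleton, iharaWord, conjWord_nil,
    GoncharovFormalIteratedIntegrals.WordSeries.one_nil, mul_one]

/-- (ii) for the family of a point, as `δΦ_{x,y} = Φ_{x,y} ⊗ Φ_{x,y}` (`Im_mul`).
[cite: Brown2012, §2.4 I0–I3; Goncharov2005, Prop 2.2] -/
theorem delta_phiK_Im (ha1 : a [] = 1)
    (hamul : ∀ u v : List Bool, a u * a v = ((shuffleWord u v).map a).sum) (x y : Bool) :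
    delta (phiK (Im a) x y) = tensor (phiK (Im a) x y) (phiK (Im a) x y) :=
  GoncharovFormalIteratedIntegrals.WordSeries.ext fun u =>
    GoncharovFormalIteratedIntegrals.WordSeries.ext fun v =>
      show ((shuffleWord u v).map fun w => Im a x w y).sum = Im a x u y * Im a x v y from
        (Im_mul ha1 hamul x y u v).symm

end Point

/-! ## The unit -/

/-- The family of the unit point is trivial: `Φ_{x,y} = 1` for all endpoints. [folklore] -/
theorem phiK_Im_one (x y : Bool) :
    phiK (Im (1 : GoncharovFormalIteratedIntegrals.WordSeries Bool B)) x y = 1 := by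
  refine GoncharovFormalIteratedIntegrals.WordSeries.ext fun w => ?_
  rw [phiK_apply]
  rcases w with _ | ⟨s, w⟩
  · rw [Im_nil]
  · have hrev : (s :: w).reverse ≠ [] := by simp
    cases x <;> cases y
    · rw [Im_self _ false (List.cons_ne_nil s w)]; rfl
    · rw [Im_false_true]
    · rw [Im_true_false,
        show (1 : GoncharovFormalIteratedIntegrals.WordSeries Bool B) (s :: w).reverse = 0 from
          GoncharovFormalIteratedIntegrals.one_apply_of_ne_nil hrev, smul_zero]; rfl
    · rw [Im_self _ true (List.cons_ne_nil s w)]; rfl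

/-- `⟨1⟩` is the identity substitution: `⟨1⟩(c) = X_c`. [cite: DeligneGoncharov2005, (5.11.4)] -/
theorem iharaWord_Im_one :
    ∀ c : List Bool,
      iharaWord (Im (1 : GoncharovFormalIteratedIntegrals.WordSeries Bool B)) c = wordX c
  | [] => rfl
  | k :: c => by
    rw [iharaWord, conjWord_cons, phiK_Im_one, phiK_Im_one, one_mul, one_mul, wordX_cons, ← iharaWord,
      iharaWord_Im_one c]

/-- **`1 ⋆ x = x`**: the unit point acts trivially. [cite: DeligneGoncharov2005, 5.12] -/
theorem one_iharaLaw (x : GoncharovFormalIteratedIntegrals.WordSeries Bool B) : iharaLaw 1 x = x := by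
  rw [iharaLaw, iharaMul, phiK_Im_one, mul_one, funext iharaWord_Im_one, contr_wordX]

/-! ## Closure: `a ⋆ b` is a point -/

section TwoPoints

variable (a b : GoncharovFormalIteratedIntegrals.WordSeries Bool B)

/-- `(a ⋆ b)(∅) = 1` for points `a, b`. [folklore] -/
theorem iharaLaw_nil_of (ha1 : a [] = 1) (hb1 : b [] = 1) : iharaLaw a b [] = 1 := by
  rw [iharaLaw_nil a ha1, hb1]

/-- **`a ⋆ b` is again a point** (a character of the shuffle algebra): Goncharov's coproduct
respects the shuffle relations ([Goncharov2005, Prop 2.2], `conv_shuffle`).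
[cite: Goncharov2005, Prop 2.2; DeligneGoncharov2005, 5.12] -/
theorem iharaLaw_mul_of (ha1 : a [] = 1)
    (hamul : ∀ u v : List Bool, a u * a v = ((shuffleWord u v).map a).sum) (hb1 : b [] = 1)
    (hbmul : ∀ u v : List Bool, b u * b v = ((shuffleWord u v).map b).sum) (u v : List Bool) :
    iharaLaw a b u * iharaLaw a b v = ((shuffleWord u v).map (iharaLaw a b)).sum := by
  have _ := hb1
  rw [iharaLaw_apply a ha1 hamul, iharaLaw_apply a ha1 hamul,
    conv_shuffle (J := cstFamily b) (K := Im a) (fun _ _ u v => hbmul u v)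
      (delta_phiK_Im a ha1 hamul) (phiK_Im_mul a ha1 hamul) false true u v]
  exact congrArg List.sum (List.map_congr_left fun w _ => (iharaLaw_apply a ha1 hamul b w).symm)

/-- The composite family `conv (Iᵐ_b) (Iᵐ_a)` has trivial loops: `Φ_{x,x} = 1` (I0 on one of the
two factors of each term). [cite: Brown2012, §2.4 I0] -/
theorem phiK_conv_Im_Im_self (ha1 : a [] = 1) (hb1 : b [] = 1) (x : Bool) :
    phiK (conv (Im b) (Im a)) x x = 1 := by
  refine GoncharovFormalIteratedIntegrals.WordSeries.ext fun w => ?_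
  rw [phiK_apply]
  by_cases hw : w = []
  · subst hw
    show conv (Im b) (Im a) x [] x = 1
    simp [conv, splittings, gapProdF, ha1, hb1]
  · rw [GoncharovFormalIteratedIntegrals.one_apply_of_ne_nil hw, conv]
    refine List.sum_eq_zero fun t ht => ?_
    obtain ⟨sp, hsp, rfl⟩ := List.mem_map.1 ht
    by_cases h : sp.2 = []
    · have hg₀ : sp.1 = w := by
        have := append_flatMap_eq_of_mem_splittings w hsp
        rwa [h, List.flatMap_nil, List.append_nil] at this
      obtain ⟨g₀, ps⟩ := sp
      simp only at h hg₀
      subst h hg₀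
      rw [gapProdF, Im_self a x hw, mul_zero]
    · rw [Im_self b x (by rwa [ne_eq, List.map_eq_nil_iff]), zero_mul]

/-- **Endpoint transport**: `conv (Iᵐ_b) (Iᵐ_a) = Iᵐ_{a ⋆ b}` as families on all endpoints — both
satisfy (iii), have trivial loops, and agree on `(0, ·, 1)` by `conv_Im_eq_iharaMul`.
[cite: Brown2012, §2.4 I0–I3, Theorem 2.4; Goncharov2005, Prop 2.2] -/
theorem conv_Im_Im (ha1 : a [] = 1)
    (hamul : ∀ u v : List Bool, a u * a v = ((shuffleWord u v).map a).sum) (hb1 : b [] = 1)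
    (hbmul : ∀ u v : List Bool, b u * b v = ((shuffleWord u v).map b).sum) :
    conv (Im b) (Im a) = Im (iharaLaw a b) := by
  have hc1 := iharaLaw_nil_of a b ha1 hb1
  have hcmul := iharaLaw_mul_of a b ha1 hamul hb1 hbmul
  refine family_eq_of_phi_eq (fun x y z => ?_) (phiK_Im_mul _ hc1 hcmul)
    (phiK_conv_Im_Im_self a b ha1 hb1 false) (phiK_conv_Im_Im_self a b ha1 hb1 true)
    (phiK_Im_self _ hc1 false) (phiK_Im_self _ hc1 true) ?_
  · refine GoncharovFormalIteratedIntegrals.WordSeries.ext fun w => ?_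
    rw [GoncharovFormalIteratedIntegrals.WordSeries.mul_apply]
    simp only [phiK_apply]
    exact (conv_path (phiK_Im_mul b hb1 hbmul) (phiK_Im_mul a ha1 hamul) x y z w).symm
  · refine GoncharovFormalIteratedIntegrals.WordSeries.ext fun w => ?_
    rw [phiK_apply, phiK_apply, Im_false_true, conv_Im_eq_iharaMul a ha1 hamul (Im b) w,
      phiK_Im_false_true]
    rfl

/-- **Associativity** `a ⋆ (b ⋆ x) = (a ⋆ b) ⋆ x` for points `a, b` and any series `x`: Ihara's
law is a monoid law on the points of `₀Π₁` acting on all series ([DG05, 5.12]: "on obtient une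
nouvelle loi de groupe `∘` sur le schéma `Π`"), from the coassociativity of Goncharov's coproduct
(`conv_assoc`) and the endpoint transport `conv_Im_Im`.
[cite: DeligneGoncharov2005, 5.12 (5.12.1); Goncharov2005, Prop 2.2; Brown2012, §2.1 (2.4)] -/
theorem iharaLaw_assoc (ha1 : a [] = 1)
    (hamul : ∀ u v : List Bool, a u * a v = ((shuffleWord u v).map a).sum) (hb1 : b [] = 1)
    (hbmul : ∀ u v : List Bool, b u * b v = ((shuffleWord u v).map b).sum)
    (x : GoncharovFormalIteratedIntegrals.WordSeries Bool B) :
    iharaLaw a (iharaLaw b x) = iharaLaw (iharaLaw a b) x := by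
  have hc1 := iharaLaw_nil_of a b ha1 hb1
  have hcmul := iharaLaw_mul_of a b ha1 hamul hb1 hbmul
  refine GoncharovFormalIteratedIntegrals.WordSeries.ext fun w => ?_
  rw [iharaLaw_apply a ha1 hamul, iharaLaw_apply _ hc1 hcmul,
    conv_congr_left (Im a) (J' := conv (cstFamily x) (Im b))
      (fun d => iharaLaw_apply b hb1 hbmul x d) w,
    conv_assoc, conv_Im_Im a b ha1 hamul hb1 hbmul]

end TwoPoints

end Brown2012

end Literature.NumberTheory.Transcendental
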